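import Literature.Analysis.Convex.Subgradient
import Mathlib.Analysis.Calculus.Gradient.Basic
import Mathlib.Analysis.Calculus.ContDiff.RCLike
import Mathlib.Analysis.InnerProductSpace.EuclideanDist
import Mathlib.Topology.MetricSpace.ProperSpace.Lemmas
import HarnessLib

/-!
# `C^{1,1}` functions from two-sided paraboloid bounds, and the `C^{1,1}` extension theorem of
# Chruściel–Delay–Galloway–Howard (Prop. 6.6)

Two results of "paraboloid calculus" on a finite-dimensional real inner product space `E`.

**1. The Caffarelli–Cabré lemma** (`hasGradientAt_of_paraboloid_bounds`,
`lipschitzWith_of_paraboloid_bounds`, `contDiff_one_of_paraboloid_bounds`). If `F : E → ℝ` admits at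
*every* point `x₀` an affine function touching from below and the paraboloid of opening `C` above
it touching from above, `F x₀ + ⟪a x₀, x - x₀⟫ ≤ F x ≤ F x₀ + ⟪a x₀, x - x₀⟫ + C ‖x - x₀‖²`, then
`F` is differentiable with gradient `a`, and `a` is `4C`-Lipschitz; so `F ∈ C^{1,1}`. (This is the
fact quoted from Caffarelli–Cabré at the end of CDGH's Appendix C.)

**2. CDGH Prop. 6.6** (`exists_contDiff_one_extension_of_paraboloids`): let `A ⊆ E`, `f : E → ℝ`,
`C > 0` and vectors `a p`, `p ∈ A`, such that (6.4) `f p + ⟪a p, x - p⟫ - (C/2)‖x - p‖² ≤ f x ≤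
f p + ⟪a p, x - p⟫ + (C/2)‖x - p‖²` for all `p, x ∈ A`, and (6.5) the lower paraboloid at `p` lies
below the upper paraboloid at `q` on all of `E`, for all `p, q ∈ A`. Then there is `F : E → ℝ` of
class `C^{1,1}` (here: `ContDiff ℝ 1 F` with Lipschitz gradient) with `F = f` on `A`. CDGH prove this
(App. C) through the convex hull of the union of the solid upper paraboloids in `E × ℝ`; the proof
here is its analytic transcription: after the normalisation `f ↦ f + (C/2)‖·‖²` (which turns the
lower paraboloids into hyperplanes and doubles the opening of the upper ones) one takes the convex
envelope `F` of the infimum `g` of the upper paraboloids — `F x = inf Σ λᵢ g(xᵢ)` over finite convex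
combinations `Σ λᵢ xᵢ = x` — and shows directly that `F` has an affine support from below (a
subgradient, `ConvexOn.exists_hasSubgradientWithinAt_of_finiteDimensional`) and a parabolic
support of opening `C` from above at every point, so that part 1 applies.

## References

* P. T. Chruściel, E. Delay, G. J. Galloway, R. Howard, *Regularity of horizons and the area
  theorem*, Ann. Henri Poincaré 2 (2001) 109–178 = arXiv:gr-qc/0001003, Prop. 6.6 and Appendix C
  (held copy, chunks p0024 and p0040). Key `ChruscielEtAl2001`.
* L. A. Caffarelli, X. Cabré, *Fully nonlinear elliptic equations*, AMS Colloquium Publ. 43 (1995),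
  §1.1 (paraboloids, punctual second differentiability).
-/

noncomputable section

open Set Filter Metric Topology InnerProductSpace
open scoped RealInnerProductSpace NNReal

namespace Literature.Analysis.Convex

variable {E : Type*} [NormedAddCommGroup E] [InnerProductSpace ℝ E]

/-! ### The Caffarelli–Cabré lemma -/

section CaffarelliCabre

variable {F : E → ℝ} {a : E → E} {C : ℝ}

/-- **Monotonicity of the slopes**: from the lower affine bounds alone,
`0 ≤ ⟪a x - a x₀, x - x₀⟫`. [folklore] -/
theorem inner_sub_slope_nonneg (hlow : ∀ x₀ x, F x₀ + ⟪a x₀, x - x₀⟫ ≤ F x) (x₀ x : E) :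
    0 ≤ ⟪a x - a x₀, x - x₀⟫ := by
  have h1 := hlow x₀ x
  have h2 := hlow x x₀
  have e : ⟪a x, x₀ - x⟫ = -⟪a x, x - x₀⟫ := by rw [← neg_sub x x₀, inner_neg_right]
  rw [inner_sub_left]
  linarith

/-- **The key one-sided estimate**: for all `x₀ x z`,
`⟪a x - a x₀, z - x⟫ ≤ C ‖z - x₀‖²` (lower bound at `x` evaluated at `z`, upper bound at `x₀`
evaluated at `z`, lower bound at `x₀` evaluated at `x`). [folklore] -/
theorem inner_sub_slope_le (hlow : ∀ x₀ x, F x₀ + ⟪a x₀, x - x₀⟫ ≤ F x)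
    (hup : ∀ x₀ x, F x ≤ F x₀ + ⟪a x₀, x - x₀⟫ + C * ‖x - x₀‖ ^ 2) (x₀ x z : E) :
    ⟪a x - a x₀, z - x⟫ ≤ C * ‖z - x₀‖ ^ 2 := by
  have h1 := hlow x z
  have h2 := hup x₀ z
  have h3 := hlow x₀ x
  have e : ⟪a x₀, z - x₀⟫ - ⟪a x₀, x - x₀⟫ = ⟪a x₀, z - x⟫ := by
    rw [← inner_sub_right]; congr 1; abel
  rw [inner_sub_left]
  linarith

/-- **Lipschitz continuity of the slopes** (Caffarelli–Cabré): under the two-sided bounds with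
opening `C ≥ 0`, `‖a x - a x₀‖ ≤ 4 C ‖x - x₀‖`. Proof: test the one-sided estimate at
`z = x + t u`, `u` the unit vector along `a x - a x₀`, `t = ‖x - x₀‖`. CDGH 2001, App. C (final
paragraph, after Caffarelli–Cabré). [cite: ChruscielEtAl2001, Appendix C] -/
theorem norm_sub_slope_le (hC : 0 ≤ C) (hlow : ∀ x₀ x, F x₀ + ⟪a x₀, x - x₀⟫ ≤ F x)
    (hup : ∀ x₀ x, F x ≤ F x₀ + ⟪a x₀, x - x₀⟫ + C * ‖x - x₀‖ ^ 2) (x₀ x : E) :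
    ‖a x - a x₀‖ ≤ 4 * C * ‖x - x₀‖ := by
  set w : E := a x - a x₀ with hw
  set r : ℝ := ‖x - x₀‖ with hr
  by_cases hw0 : w = 0
  · rw [hw0, norm_zero]; positivity
  by_cases hr0 : r = 0
  · -- `x = x₀`, so `w = 0`
    have : x = x₀ := by rwa [hr, norm_eq_zero, sub_eq_zero] at hr0
    exact absurd (by simp [hw, this]) hw0
  have hrpos : 0 < r := lt_of_le_of_ne (norm_nonneg _) (Ne.symm hr0)
  have hwpos : 0 < ‖w‖ := norm_pos_iff.mpr hw0
  -- `z = x + (r / ‖w‖) • w`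
  set z : E := x + (r / ‖w‖) • w with hz
  have key := inner_sub_slope_le hlow hup x₀ x z
  rw [← hw] at key
  have hzx : z - x = (r / ‖w‖) • w := by rw [hz]; abel
  have hlhs : ⟪w, z - x⟫ = r * ‖w‖ := by
    rw [hzx, real_inner_smul_right, real_inner_self_eq_norm_sq]
    field_simp
  have hzx₀ : ‖z - x₀‖ ≤ 2 * r := by
    have e : z - x₀ = (x - x₀) + (r / ‖w‖) • w := by rw [hz]; abel
    rw [e]
    calc ‖(x - x₀) + (r / ‖w‖) • w‖ ≤ ‖x - x₀‖ + ‖(r / ‖w‖) • w‖ := norm_add_le _ _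
      _ = r + r := by
          rw [← hr, norm_smul, Real.norm_of_nonneg (by positivity)]
          field_simp
      _ = 2 * r := by ring
  have hrhs : C * ‖z - x₀‖ ^ 2 ≤ C * (2 * r) ^ 2 := by
    gcongr
  rw [hlhs] at key
  have : r * ‖w‖ ≤ 4 * C * r * r := by nlinarith
  have := le_of_mul_le_mul_left (by nlinarith : r * ‖w‖ ≤ r * (4 * C * r)) hrpos
  linarith

/-- The slope map `a` is `4C`-Lipschitz. [cite: ChruscielEtAl2001, Appendix C] -/
theorem lipschitzWith_of_paraboloid_bounds (hC : 0 ≤ C)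
    (hlow : ∀ x₀ x, F x₀ + ⟪a x₀, x - x₀⟫ ≤ F x)
    (hup : ∀ x₀ x, F x ≤ F x₀ + ⟪a x₀, x - x₀⟫ + C * ‖x - x₀‖ ^ 2) :
    LipschitzWith (Real.toNNReal (4 * C)) a := by
  refine LipschitzWith.of_dist_le_mul fun x y ↦ ?_
  rw [dist_eq_norm, dist_eq_norm, Real.coe_toNNReal _ (by positivity)]
  exact norm_sub_slope_le hC hlow hup y x

/-- **Differentiability**: under the two-sided bounds, `F` has gradient `a x₀` at every `x₀`
(`|F x - F x₀ - ⟪a x₀, x - x₀⟫| ≤ C‖x - x₀‖²`). [cite: ChruscielEtAl2001, Appendix C] -/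
theorem hasGradientAt_of_paraboloid_bounds [CompleteSpace E] (hC : 0 ≤ C)
    (hlow : ∀ x₀ x, F x₀ + ⟪a x₀, x - x₀⟫ ≤ F x)
    (hup : ∀ x₀ x, F x ≤ F x₀ + ⟪a x₀, x - x₀⟫ + C * ‖x - x₀‖ ^ 2) (x₀ : E) :
    HasGradientAt F (a x₀) x₀ := by
  rw [hasGradientAt_iff_hasFDerivAt, hasFDerivAt_iff_isLittleO_nhds_zero]
  refine Asymptotics.isLittleO_iff.mpr fun c hc ↦ ?_
  have hmem : ball (0 : E) (c / (C + 1)) ∈ 𝓝 (0 : E) := ball_mem_nhds 0 (by positivity)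
  filter_upwards [hmem] with h hh
  rw [mem_ball, dist_zero_right] at hh
  have h1 := hlow x₀ (x₀ + h)
  have h2 := hup x₀ (x₀ + h)
  rw [add_sub_cancel_left] at h1 h2
  rw [toDual_apply_apply, Real.norm_eq_abs, abs_le]
  have hC1 : C * ‖h‖ ^ 2 ≤ c * ‖h‖ := by
    calc C * ‖h‖ ^ 2 = (C * ‖h‖) * ‖h‖ := by ring
      _ ≤ c * ‖h‖ := by
          gcongr
          calc C * ‖h‖ ≤ (C + 1) * ‖h‖ := by gcongr; linarith
            _ ≤ (C + 1) * (c / (C + 1)) := by gcongr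
            _ = c := by field_simp
  constructor
  · nlinarith [norm_nonneg h]
  · linarith

/-- **`F ∈ C^{1,1}`**: `F` is continuously differentiable (indeed with Lipschitz derivative
`x ↦ ⟪a x, ·⟫`). [cite: ChruscielEtAl2001, Appendix C] -/
theorem contDiff_one_of_paraboloid_bounds [CompleteSpace E] (hC : 0 ≤ C)
    (hlow : ∀ x₀ x, F x₀ + ⟪a x₀, x - x₀⟫ ≤ F x)
    (hup : ∀ x₀ x, F x ≤ F x₀ + ⟪a x₀, x - x₀⟫ + C * ‖x - x₀‖ ^ 2) : ContDiff ℝ 1 F := by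
  rw [contDiff_one_iff_hasFDerivAt]
  refine ⟨fun x ↦ toDual ℝ E (a x), ?_, fun x ↦ hasGradientAt_of_paraboloid_bounds hC hlow hup x⟩
  exact (toDual ℝ E).continuous.comp (lipschitzWith_of_paraboloid_bounds hC hlow hup).continuous

end CaffarelliCabre

/-! ### The convex envelope of a family of paraboloids dominating a family of affine functions -/

section Envelope

variable {P : E → E → ℝ} {A : Set E}

/-- The **admissible convex combinations** representing `x`: finitely supported nonnegative
weights on pairs `(z, q) ∈ E × A` with total mass `1` and barycentre `∑ w (z, q) z = x`
(proof device for the convex envelope of Chruściel–Delay–Galloway–Howard 2001, App. C).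
[cite: ChruscielEtAl2001, App. C] -/
def IsCombination (A : Set E) (w : E × E →₀ ℝ) (x : E) : Prop :=
  (∀ zq, 0 ≤ w zq) ∧ (∀ zq ∈ w.support, zq.2 ∈ A) ∧ (w.sum fun _ c ↦ c) = 1 ∧
    (w.sum fun zq c ↦ c • zq.1) = x

/-- The values `∑ w (z, q) P q z` of admissible combinations representing `x` (whose infimum is
the convex envelope of the family `P q`, `q ∈ A`). [cite: ChruscielEtAl2001, App. C] -/
def envelopeVals (P : E → E → ℝ) (A : Set E) (x : E) : Set ℝ :=
  {r | ∃ w : E × E →₀ ℝ, IsCombination A w x ∧ r = w.sum fun zq c ↦ c * P zq.2 zq.1}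

/-- The **convex envelope** of the family of functions `P q`, `q ∈ A` (the largest convex
function below all of them): `x ↦ inf ∑ w (z, q) P q z` over admissible combinations representing
`x`. In CDGH's Appendix C this is the function whose graph is the lower boundary of the convex hull
`Q` of the union of the solid paraboloids. [cite: ChruscielEtAl2001, Appendix C] -/
def envelope (P : E → E → ℝ) (A : Set E) (x : E) : ℝ := sInf (envelopeVals P A x)

/-- The one-point combination `(x, q)` with weight `1`. [folklore] -/
theorem isCombination_single {q : E} (hq : q ∈ A) (x : E) :
    IsCombination A (Finsupp.single (x, q) 1) x := by
  classical
  refine ⟨fun zq ↦ ?_, fun zq hzq ↦ ?_, ?_, ?_⟩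
  · rw [Finsupp.single_apply]; split_ifs <;> norm_num
  · rw [Finsupp.mem_support_single] at hzq
    rw [hzq.1]; exact hq
  · simp
  · simp

/-- The value of the one-point combination is `P q x`. [folklore] -/
theorem mem_envelopeVals_single {q : E} (hq : q ∈ A) (x : E) : P q x ∈ envelopeVals P A x :=
  ⟨Finsupp.single (x, q) 1, isCombination_single hq x, by simp⟩

/-- The set of values is nonempty if `A` is. [folklore] -/
theorem envelopeVals_nonempty (hA : A.Nonempty) (x : E) : (envelopeVals P A x).Nonempty :=
  let ⟨_, hq⟩ := hA; ⟨_, mem_envelopeVals_single hq x⟩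

/-- **Affine functions are exact on combinations**: `∑ w (z,q) (f₀ + ⟪v, z - p⟫) = f₀ + ⟪v, x - p⟫`
for an admissible combination representing `x`. [folklore] -/
theorem sum_affine_eq {w : E × E →₀ ℝ} {x : E} (hw : IsCombination A w x) (f₀ : ℝ) (v p : E) :
    (w.sum fun zq c ↦ c * (f₀ + ⟪v, zq.1 - p⟫)) = f₀ + ⟪v, x - p⟫ := by
  obtain ⟨-, -, hsum, hbar⟩ := hw
  have h1 : (w.sum fun zq c ↦ c * (f₀ + ⟪v, zq.1 - p⟫)) =
      (w.sum fun _ c ↦ c) * f₀ + ⟪v, w.sum fun zq c ↦ c • zq.1⟫ - (w.sum fun _ c ↦ c) * ⟪v, p⟫ := by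
    simp only [Finsupp.sum, Finset.sum_mul, inner_sum, real_inner_smul_right, ← Finset.sum_sub_distrib,
      ← Finset.sum_add_distrib]
    refine Finset.sum_congr rfl fun zq _ ↦ ?_
    rw [inner_sub_right]; ring
  rw [h1, hsum, hbar, one_mul, one_mul, inner_sub_right]
  ring

/-- **Lower bound**: if the affine function `ℓ = f₀ + ⟪v, · - p⟫` is below every `P q`, `q ∈ A`,
then `ℓ x ≤ r` for every value `r ∈ envelopeVals P A x`. [folklore] -/
theorem affine_le_of_mem_envelopeVals {f₀ : ℝ} {v p : E} (hle : ∀ q ∈ A, ∀ z, f₀ + ⟪v, z - p⟫ ≤ P q z)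
    {x : E} {r : ℝ} (hr : r ∈ envelopeVals P A x) : f₀ + ⟪v, x - p⟫ ≤ r := by
  obtain ⟨w, hw, rfl⟩ := hr
  rw [← sum_affine_eq hw f₀ v p]
  simp only [Finsupp.sum]
  refine Finset.sum_le_sum fun zq hzq ↦ ?_
  exact mul_le_mul_of_nonneg_left (hle zq.2 (hw.2.1 zq hzq) zq.1) (hw.1 zq)

/-- The values are bounded below as soon as one affine function is below every `P q`. [folklore] -/
theorem bddBelow_envelopeVals {f₀ : ℝ} {v p : E} (hle : ∀ q ∈ A, ∀ z, f₀ + ⟪v, z - p⟫ ≤ P q z)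
    (x : E) : BddBelow (envelopeVals P A x) :=
  ⟨f₀ + ⟪v, x - p⟫, fun _ hr ↦ affine_le_of_mem_envelopeVals hle hr⟩

/-- **The envelope is above the affine minorants.** [folklore] -/
theorem affine_le_envelope (hA : A.Nonempty) {f₀ : ℝ} {v p : E}
    (hle : ∀ q ∈ A, ∀ z, f₀ + ⟪v, z - p⟫ ≤ P q z) (x : E) : f₀ + ⟪v, x - p⟫ ≤ envelope P A x :=
  le_csInf (envelopeVals_nonempty hA x) fun _ hr ↦ affine_le_of_mem_envelopeVals hle hr

/-- **The envelope is below every `P q`.** [folklore] -/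
theorem envelope_le {f₀ : ℝ} {v p : E} (hle : ∀ q ∈ A, ∀ z, f₀ + ⟪v, z - p⟫ ≤ P q z) {q : E}
    (hq : q ∈ A) (x : E) : envelope P A x ≤ P q x :=
  csInf_le (bddBelow_envelopeVals hle x) (mem_envelopeVals_single hq x)

/-- **Merging two combinations**: `α • w₁ + β • w₂` represents `α • x + β • y` and its value is the
corresponding combination of values. [folklore] -/
theorem isCombination_add_smul {w₁ w₂ : E × E →₀ ℝ} {x y : E} (h₁ : IsCombination A w₁ x)
    (h₂ : IsCombination A w₂ y) {α β : ℝ} (hα : 0 ≤ α) (hβ : 0 ≤ β) (hαβ : α + β = 1) :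
    IsCombination A (α • w₁ + β • w₂) (α • x + β • y) := by
  classical
  obtain ⟨h1p, h1A, h1s, h1b⟩ := h₁
  obtain ⟨h2p, h2A, h2s, h2b⟩ := h₂
  refine ⟨fun zq ↦ ?_, fun zq hzq ↦ ?_, ?_, ?_⟩
  · simp only [Finsupp.coe_add, Finsupp.coe_smul, Pi.add_apply, Pi.smul_apply, smul_eq_mul]
    exact add_nonneg (mul_nonneg hα (h1p zq)) (mul_nonneg hβ (h2p zq))
  · -- a point of the support of the sum lies in one of the supports
    have hmem : zq ∈ (α • w₁).support ∪ (β • w₂).support := Finsupp.support_add hzq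
    rcases Finset.mem_union.mp hmem with h | h
    · exact h1A zq (Finsupp.support_smul h)
    · exact h2A zq (Finsupp.support_smul h)
  · rw [Finsupp.sum_add_index' (h := fun (_ : E × E) (c : ℝ) ↦ c) (fun _ ↦ rfl) (fun _ _ _ ↦ rfl),
      Finsupp.sum_smul_index' (h := fun (_ : E × E) (c : ℝ) ↦ c) (fun _ ↦ rfl),
      Finsupp.sum_smul_index' (h := fun (_ : E × E) (c : ℝ) ↦ c) (fun _ ↦ rfl)]
    have e1 : (w₁.sum fun _ c ↦ α • c) = α * w₁.sum fun _ c ↦ c := by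
      simp only [Finsupp.sum, smul_eq_mul, Finset.mul_sum]
    have e2 : (w₂.sum fun _ c ↦ β • c) = β * w₂.sum fun _ c ↦ c := by
      simp only [Finsupp.sum, smul_eq_mul, Finset.mul_sum]
    rw [e1, e2, h1s, h2s, mul_one, mul_one, hαβ]
  · rw [Finsupp.sum_add_index' (h := fun (zq : E × E) (c : ℝ) ↦ c • zq.1) (fun a ↦ zero_smul ℝ a.1)
        (fun a b₁ b₂ ↦ add_smul b₁ b₂ a.1),
      Finsupp.sum_smul_index' (h := fun (zq : E × E) (c : ℝ) ↦ c • zq.1) (fun a ↦ zero_smul ℝ a.1),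
      Finsupp.sum_smul_index' (h := fun (zq : E × E) (c : ℝ) ↦ c • zq.1) (fun a ↦ zero_smul ℝ a.1)]
    have e1 : (w₁.sum fun zq c ↦ (α • c) • zq.1) = α • w₁.sum fun zq c ↦ c • zq.1 := by
      simp only [Finsupp.sum, smul_eq_mul, mul_smul, Finset.smul_sum]
    have e2 : (w₂.sum fun zq c ↦ (β • c) • zq.1) = β • w₂.sum fun zq c ↦ c • zq.1 := by
      simp only [Finsupp.sum, smul_eq_mul, mul_smul, Finset.smul_sum]
    rw [e1, e2, h1b, h2b]

omit [NormedAddCommGroup E] [InnerProductSpace ℝ E] in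
/-- The value of a merged combination. [folklore] -/
theorem sum_add_smul_value (w₁ w₂ : E × E →₀ ℝ) (α β : ℝ) :
    ((α • w₁ + β • w₂).sum fun zq c ↦ c * P zq.2 zq.1) =
      α * (w₁.sum fun zq c ↦ c * P zq.2 zq.1) + β * (w₂.sum fun zq c ↦ c * P zq.2 zq.1) := by
  classical
  rw [Finsupp.sum_add_index' (h := fun (zq : E × E) (c : ℝ) ↦ c * P zq.2 zq.1) (fun _ ↦ zero_mul _)
      (fun _ _ _ ↦ add_mul _ _ _),
    Finsupp.sum_smul_index' (h := fun (zq : E × E) (c : ℝ) ↦ c * P zq.2 zq.1) (fun _ ↦ zero_mul _),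
    Finsupp.sum_smul_index' (h := fun (zq : E × E) (c : ℝ) ↦ c * P zq.2 zq.1) (fun _ ↦ zero_mul _)]
  simp only [Finsupp.sum, smul_eq_mul, mul_assoc, Finset.mul_sum]

/-- **The envelope is convex** (on the whole space), provided some affine function is below every
`P q` (so that all the infima are finite) and `A` is nonempty. [folklore] -/
theorem convexOn_envelope (hA : A.Nonempty) {f₀ : ℝ} {v p : E}
    (hle : ∀ q ∈ A, ∀ z, f₀ + ⟪v, z - p⟫ ≤ P q z) : ConvexOn ℝ univ (envelope P A) := by
  refine ⟨convex_univ, fun x _ y _ α β hα hβ hαβ ↦ ?_⟩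
  -- `envelope (αx + βy) ≤ α r₁ + β r₂` for all values `r₁, r₂`
  have key : ∀ r₁ ∈ envelopeVals P A x, ∀ r₂ ∈ envelopeVals P A y,
      envelope P A (α • x + β • y) ≤ α * r₁ + β * r₂ := by
    rintro r₁ ⟨w₁, hw₁, rfl⟩ r₂ ⟨w₂, hw₂, rfl⟩
    refine csInf_le (bddBelow_envelopeVals hle _) ⟨α • w₁ + β • w₂,
      isCombination_add_smul hw₁ hw₂ hα hβ hαβ, ?_⟩
    rw [sum_add_smul_value]
  -- pass to the infima
  have hne₁ := envelopeVals_nonempty (P := P) hA x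
  have hne₂ := envelopeVals_nonempty (P := P) hA y
  have hbdd₁ := bddBelow_envelopeVals hle (P := P) x
  have hbdd₂ := bddBelow_envelopeVals hle (P := P) y
  show envelope P A (α • x + β • y) ≤ α • envelope P A x + β • envelope P A y
  simp only [smul_eq_mul]
  -- first in `r₂`
  have step : ∀ r₁ ∈ envelopeVals P A x, envelope P A (α • x + β • y) ≤ α * r₁ + β * envelope P A y := by
    intro r₁ hr₁
    rcases hβ.lt_or_eq with hβ0 | hβ0
    · have : (envelope P A (α • x + β • y) - α * r₁) / β ≤ envelope P A y := by
        refine le_csInf hne₂ fun r₂ hr₂ ↦ ?_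
        rw [div_le_iff₀ hβ0]
        linarith [key r₁ hr₁ r₂ hr₂]
      rw [div_le_iff₀ hβ0] at this
      linarith
    · obtain ⟨r₂, hr₂⟩ := hne₂
      have := key r₁ hr₁ r₂ hr₂
      rw [← hβ0] at this ⊢
      simpa using this
  rcases hα.lt_or_eq with hα0 | hα0
  · have : (envelope P A (α • x + β • y) - β * envelope P A y) / α ≤ envelope P A x := by
      refine le_csInf hne₁ fun r₁ hr₁ ↦ ?_
      rw [div_le_iff₀ hα0]
      linarith [step r₁ hr₁]
    rw [div_le_iff₀ hα0] at this
    linarith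
  · obtain ⟨r₁, hr₁⟩ := hne₁
    have := step r₁ hr₁
    rw [← hα0] at this ⊢
    simpa using this

/-- **Translating a combination**: shifting all points by `d` gives an admissible combination
representing `x + d`. [folklore] -/
theorem isCombination_embDomain_add {w : E × E →₀ ℝ} {x : E} (hw : IsCombination A w x) (d : E) :
    IsCombination A (w.embDomain ⟨fun zq ↦ (zq.1 + d, zq.2), fun zq zq' h ↦ by
      simpa [Prod.ext_iff] using h⟩) (x + d) := by
  classical
  set T : E × E ↪ E × E := ⟨fun zq ↦ (zq.1 + d, zq.2), fun zq zq' h ↦ by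
      simpa [Prod.ext_iff] using h⟩ with hT
  obtain ⟨hp, hA, hs, hb⟩ := hw
  refine ⟨fun zq ↦ ?_, fun zq hzq ↦ ?_, ?_, ?_⟩
  · by_cases h : zq ∈ Set.range T
    · obtain ⟨zq', rfl⟩ := h
      rw [Finsupp.embDomain_apply_self]; exact hp zq'
    · rw [Finsupp.embDomain_notin_range _ _ _ h]
  · rw [Finsupp.support_embDomain, Finset.mem_map] at hzq
    obtain ⟨zq', hzq', rfl⟩ := hzq
    exact hA zq' hzq'
  · rw [Finsupp.sum_embDomain]; exact hs
  · rw [Finsupp.sum_embDomain]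
    show (w.sum fun zq c ↦ c • (zq.1 + d)) = x + d
    have : (w.sum fun zq c ↦ c • (zq.1 + d)) = (w.sum fun zq c ↦ c • zq.1) + (w.sum fun _ c ↦ c) • d := by
      simp only [Finsupp.sum, smul_add, Finset.sum_add_distrib, Finset.sum_smul]
    rw [this, hb, hs, one_smul]

end Envelope

/-! ### The normalised extension problem: hyperplanes below paraboloids -/

section Normalised

variable [FiniteDimensional ℝ E] {A : Set E} {f : E → ℝ} {a : E → E} {C : ℝ}

/-- The upper paraboloid of opening `C` attached to `q`: `P q z = f q + ⟪a q, z - q⟫ + C‖z - q‖²`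
(the right-hand side of CDGH's (6.5) / (C.1)). [cite: ChruscielEtAl2001, Prop. 6.6 and App. C] -/
def upperParab (f : E → ℝ) (a : E → E) (C : ℝ) (q z : E) : ℝ := f q + ⟪a q, z - q⟫ + C * ‖z - q‖ ^ 2

omit [FiniteDimensional ℝ E] in
/-- **Paraboloids are exactly quadratic**:
`P q (z + d) = P q z + ⟪a q + (2C) • (z - q), d⟫ + C‖d‖²`. [folklore] -/
theorem upperParab_add (q z d : E) :
    upperParab f a C q (z + d) =
      upperParab f a C q z + ⟪a q + (2 * C) • (z - q), d⟫ + C * ‖d‖ ^ 2 := by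
  simp only [upperParab]
  have e1 : z + d - q = (z - q) + d := by abel
  rw [e1, inner_add_right, ← real_inner_self_eq_norm_sq, ← real_inner_self_eq_norm_sq,
    ← real_inner_self_eq_norm_sq]
  simp only [inner_add_left, inner_add_right, real_inner_smul_left, real_inner_comm d (z - q)]
  ring

omit [FiniteDimensional ℝ E] in
/-- **The key upper bound** (a supporting paraboloid of opening `C` at every point of the graph of
the envelope): if the hyperplanes `ℓ p = f p + ⟪a p, · - p⟫`, `p ∈ A`, are below the paraboloids
`P q`, `q ∈ A`, everywhere, `A ≠ ∅`, `C > 0`, and `s` is a subgradient of the envelope `F` at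
`x₀`, then `F x ≤ F x₀ + ⟪s, x - x₀⟫ + C‖x - x₀‖²` for all `x`. Proof: an almost optimal
combination for `x₀`, translated by `d = x - x₀`, bounds `F x` by `F x₀ + ε + ⟪b, d⟫ + C‖d‖²`
with `b` the corresponding combination of gradients; comparing with the subgradient inequality
along `-μ d` controls `⟪b - s, d⟫` by `ε/μ + C μ ‖d‖²`; let `ε → 0`, then `μ → 0`. (CDGH, App. C:
"for each point `z ∈ ∂Q` there is a supporting paraboloid".) [cite: ChruscielEtAl2001, Appendix C] -/
theorem envelope_le_parab (hC : 0 < C) (hA : A.Nonempty)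
    (h65 : ∀ p ∈ A, ∀ q ∈ A, ∀ z, f p + ⟪a p, z - p⟫ ≤ upperParab f a C q z) {x₀ s : E}
    (hs : HasSubgradientWithinAt (envelope (upperParab f a C) A) univ s x₀) (x : E) :
    envelope (upperParab f a C) A x ≤
      envelope (upperParab f a C) A x₀ + ⟪s, x - x₀⟫ + C * ‖x - x₀‖ ^ 2 := by
  classical
  obtain ⟨p₀, hp₀⟩ := hA
  have hle : ∀ q ∈ A, ∀ z, f p₀ + ⟪a p₀, z - p₀⟫ ≤ upperParab f a C q z := h65 p₀ hp₀
  set F := envelope (upperParab f a C) A with hF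
  set d : E := x - x₀ with hd
  -- Step 1: for every `ε > 0` a vector `b` with `F (x₀ + d') ≤ F x₀ + ε + ⟪b, d'⟫ + C‖d'‖²` for ALL `d'`
  have step1 : ∀ ε > 0, ∃ b : E, ∀ d' : E, F (x₀ + d') < F x₀ + ε + ⟪b, d'⟫ + C * ‖d'‖ ^ 2 := by
    intro ε hε
    have hlt : F x₀ < F x₀ + ε := by linarith
    obtain ⟨r, hr, hrlt⟩ := exists_lt_of_csInf_lt (envelopeVals_nonempty ⟨p₀, hp₀⟩ x₀) hlt
    obtain ⟨w, hw, rfl⟩ := hr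
    refine ⟨w.sum fun zq c ↦ c • (a zq.2 + (2 * C) • (zq.1 - zq.2)), fun d' ↦ ?_⟩
    -- the translated combination bounds `F (x₀ + d')`
    have hcomb := isCombination_embDomain_add hw d'
    have hval : F (x₀ + d') ≤ (w.embDomain ⟨fun zq ↦ (zq.1 + d', zq.2), fun zq zq' h ↦ by
        simpa [Prod.ext_iff] using h⟩).sum fun zq c ↦ c * upperParab f a C zq.2 zq.1 :=
      csInf_le (bddBelow_envelopeVals hle _) ⟨_, hcomb, rfl⟩
    rw [Finsupp.sum_embDomain] at hval
    have hexp : (w.sum fun zq c ↦ c * upperParab f a C zq.2 (zq.1 + d')) =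
        (w.sum fun zq c ↦ c * upperParab f a C zq.2 zq.1) +
          ⟪w.sum fun zq c ↦ c • (a zq.2 + (2 * C) • (zq.1 - zq.2)), d'⟫ +
          (w.sum fun _ c ↦ c) * (C * ‖d'‖ ^ 2) := by
      simp only [Finsupp.sum, sum_inner, real_inner_smul_left, Finset.sum_mul, ← Finset.sum_add_distrib]
      refine Finset.sum_congr rfl fun zq _ ↦ ?_
      rw [upperParab_add]; ring
    rw [hw.2.2.1, one_mul] at hexp
    have : F (x₀ + d') ≤ (w.sum fun zq c ↦ c * upperParab f a C zq.2 zq.1) +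
        ⟪w.sum fun zq c ↦ c • (a zq.2 + (2 * C) • (zq.1 - zq.2)), d'⟫ + C * ‖d'‖ ^ 2 := by
      have h : F (x₀ + d') ≤ w.sum fun zq c ↦ c * upperParab f a C zq.2 (zq.1 + d') := hval
      rw [hexp] at h
      exact h
    linarith
  -- Step 2: `⟪b - s, d⟫ ≤ ε / μ + C μ ‖d‖²` for every `μ > 0`, hence the bound up to `ε + ε/μ + Cμ‖d‖²`
  have step2 : ∀ ε > 0, ∀ μ > 0,
      F (x₀ + d) < F x₀ + ε + ⟪s, d⟫ + (ε / μ + C * μ * ‖d‖ ^ 2) + C * ‖d‖ ^ 2 := by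
    intro ε hε μ hμ
    obtain ⟨b, hb⟩ := step1 ε hε
    have h1 := hb d
    -- subgradient inequality along `-μ • d`
    have h2 : F x₀ + ⟪s, (x₀ + (-μ) • d) - x₀⟫ ≤ F (x₀ + (-μ) • d) := hs _ (mem_univ _)
    have h3 := hb ((-μ) • d)
    rw [add_sub_cancel_left, real_inner_smul_right] at h2
    rw [real_inner_smul_right, norm_smul, Real.norm_eq_abs, abs_neg, abs_of_pos hμ] at h3
    -- `-μ⟪s,d⟫ ≤ F(x₀ - μd) - F x₀ < ε - μ⟪b,d⟫ + Cμ²‖d‖²`, so `μ ⟪b - s, d⟫ < ε + C μ² ‖d‖²`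
    have h4 : μ * ⟪b - s, d⟫ < ε + C * μ ^ 2 * ‖d‖ ^ 2 := by
      rw [inner_sub_left]; nlinarith
    have h5 : ⟪b - s, d⟫ < ε / μ + C * μ * ‖d‖ ^ 2 := by
      have := div_lt_div_of_pos_right h4 hμ
      rw [mul_div_cancel_left₀ _ hμ.ne'] at this
      calc ⟪b - s, d⟫ < (ε + C * μ ^ 2 * ‖d‖ ^ 2) / μ := this
        _ = ε / μ + C * μ * ‖d‖ ^ 2 := by field_simp
    have h6 : ⟪b, d⟫ = ⟪s, d⟫ + ⟪b - s, d⟫ := by rw [inner_sub_left]; ring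
    rw [h6] at h1
    linarith
  -- Step 3: let `ε → 0`, then `μ → 0`
  have step3 : ∀ μ > 0, F (x₀ + d) ≤ F x₀ + ⟪s, d⟫ + C * μ * ‖d‖ ^ 2 + C * ‖d‖ ^ 2 := by
    intro μ hμ
    refine le_of_forall_pos_lt_add fun δ hδ ↦ ?_
    -- choose `ε` with `ε + ε / μ ≤ δ`
    set ε : ℝ := δ * μ / (2 * (μ + 1)) with hε
    have hε0 : 0 < ε := by positivity
    have hεδ : ε + ε / μ < δ := by
      rw [hε]
      have h1 : δ * μ / (2 * (μ + 1)) + δ * μ / (2 * (μ + 1)) / μ = δ / 2 := by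
        field_simp
      linarith
    have := step2 ε hε0 μ hμ
    linarith
  have step4 : F (x₀ + d) ≤ F x₀ + ⟪s, d⟫ + C * ‖d‖ ^ 2 := by
    refine le_of_forall_pos_lt_add fun δ hδ ↦ ?_
    have hpos : 0 < C * ‖d‖ ^ 2 + 1 := by positivity
    have := step3 (δ / (2 * (C * ‖d‖ ^ 2 + 1))) (by positivity)
    have h1 : C * (δ / (2 * (C * ‖d‖ ^ 2 + 1))) * ‖d‖ ^ 2 < δ := by
      rw [show C * (δ / (2 * (C * ‖d‖ ^ 2 + 1))) * ‖d‖ ^ 2 = δ * (C * ‖d‖ ^ 2) / (2 * (C * ‖d‖ ^ 2 + 1))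
        by ring]
      rw [div_lt_iff₀ (by positivity)]
      nlinarith
    linarith
  have hx : x₀ + d = x := by rw [hd]; abel
  rw [hx, hd] at step4
  exact step4

/-- **The normalised extension theorem.** If `C > 0` and the hyperplanes
`ℓ p = f p + ⟪a p, · - p⟫`, `p ∈ A`, are everywhere below the paraboloids
`P q = f q + ⟪a q, · - q⟫ + C‖· - q‖²`, `q ∈ A`, then the convex envelope `F` of the `P q` equals `f`
on `A` and admits at every point an affine support from below and a parabolic support of opening `C`
from above: `F x₀ + ⟪G x₀, x - x₀⟫ ≤ F x ≤ F x₀ + ⟪G x₀, x - x₀⟫ + C‖x - x₀‖²`. CDGH, App. C.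
[cite: ChruscielEtAl2001, Appendix C] -/
theorem exists_paraboloid_bounds_extension (hC : 0 < C) (hA : A.Nonempty)
    (h65 : ∀ p ∈ A, ∀ q ∈ A, ∀ z, f p + ⟪a p, z - p⟫ ≤ upperParab f a C q z) :
    ∃ (F : E → ℝ) (G : E → E), (∀ x₀ x, F x₀ + ⟪G x₀, x - x₀⟫ ≤ F x) ∧
      (∀ x₀ x, F x ≤ F x₀ + ⟪G x₀, x - x₀⟫ + C * ‖x - x₀‖ ^ 2) ∧ ∀ p ∈ A, F p = f p := by
  obtain ⟨p₀, hp₀⟩ := hA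
  have hle : ∀ q ∈ A, ∀ z, f p₀ + ⟪a p₀, z - p₀⟫ ≤ upperParab f a C q z := h65 p₀ hp₀
  set F := envelope (upperParab f a C) A with hF
  have hconv : ConvexOn ℝ univ F := convexOn_envelope ⟨p₀, hp₀⟩ hle
  -- a subgradient at every point
  have hsub : ∀ x₀, ∃ s, HasSubgradientWithinAt F univ s x₀ := fun x₀ ↦
    ConvexOn.exists_hasSubgradientWithinAt_of_finiteDimensional hconv isOpen_univ (mem_univ x₀)
  choose G hG using hsub
  refine ⟨F, G, fun x₀ x ↦ hG x₀ x (mem_univ x), fun x₀ x ↦ envelope_le_parab hC ⟨p₀, hp₀⟩ h65 (hG x₀) x,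
    fun p hp ↦ le_antisymm ?_ ?_⟩
  · -- `F p ≤ P p p = f p`
    have := envelope_le hle hp p
    simpa [upperParab] using this
  · -- `f p = ℓ p p ≤ F p`
    have := affine_le_envelope ⟨p₀, hp₀⟩ (h65 p hp) p
    simpa using this

end Normalised

/-! ### CDGH Prop. 6.6 -/

section Prop66

variable [FiniteDimensional ℝ E] {A : Set E} {f : E → ℝ} {a : E → E} {C : ℝ}

/-- **The `C^{1,1}` extension theorem of Chruściel–Delay–Galloway–Howard** (Ann. Henri Poincaré 2
(2001), Prop. 6.6; proof in their Appendix C): "Let `A ⊂ ℝⁿ` and `f : A → ℝ`. Assume there is a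
constant `C > 0` and for each `p ∈ A` there is a vector `a_p ∈ ℝⁿ` so that the inequalities
`f(p) + ⟨x - p, a_p⟩ - (C/2)‖x - p‖² ≤ f(x) ≤ f(p) + ⟨x - p, a_p⟩ + (C/2)‖x - p‖²` hold for all
`x ∈ A`. Also assume that for all `p, q ∈ A` and all `x ∈ ℝⁿ`,
`f(p) + ⟨x - p, a_p⟩ - (C/2)‖x - p‖² ≤ f(q) + ⟨x - q, a_q⟩ + (C/2)‖x - q‖²`. Then there is a
function `F : ℝⁿ → ℝ` of class `C^{1,1}` so that `f` is the restriction of `F` to `A`." Here on any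
finite-dimensional real inner product space; the first family of inequalities follows from the
second (take `q = x`, resp. `p = x`) and is therefore not assumed; `C^{1,1}` is rendered as:
`F` has at every point a gradient `G x`, `G` is Lipschitz (constant `5C`), and `F` is `C¹`. The
proof is the analytic form of CDGH's: normalise by adding `(C/2)‖·‖²`, take the convex envelope of
the upper paraboloids (`exists_paraboloid_bounds_extension`), apply the Caffarelli–Cabré lemma, and
subtract `(C/2)‖·‖²` again. [cite: ChruscielEtAl2001, Prop. 6.6] -/
theorem exists_contDiff_one_extension_of_paraboloids (hC : 0 < C)
    (h65 : ∀ p ∈ A, ∀ q ∈ A, ∀ x : E,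
      f p + ⟪a p, x - p⟫ - C / 2 * ‖x - p‖ ^ 2 ≤ f q + ⟪a q, x - q⟫ + C / 2 * ‖x - q‖ ^ 2) :
    ∃ (F : E → ℝ) (G : E → E), (∀ x, HasGradientAt F (G x) x) ∧
      LipschitzWith (Real.toNNReal (5 * C)) G ∧ ContDiff ℝ 1 F ∧ EqOn F f A := by
  haveI : CompleteSpace E := FiniteDimensional.complete ℝ E
  rcases A.eq_empty_or_nonempty with hA | hA
  · refine ⟨0, 0, fun x ↦ ?_, ?_, contDiff_const, by simp [hA]⟩
    · show HasGradientAt (fun _ ↦ (0 : ℝ)) 0 x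
      rw [hasGradientAt_iff_hasFDerivAt, map_zero]
      exact hasFDerivAt_const 0 x
    · exact (LipschitzWith.const' (0 : E)).weaken bot_le
  -- normalised data
  set fn : E → ℝ := fun x ↦ f x + C / 2 * ‖x‖ ^ 2 with hfn
  set an : E → E := fun p ↦ a p + C • p with han
  have h65n : ∀ p ∈ A, ∀ q ∈ A, ∀ z, fn p + ⟪an p, z - p⟫ ≤ upperParab fn an C q z := by
    intro p hp q hq z
    have h := h65 p hp q hq z
    show f p + C / 2 * ‖p‖ ^ 2 + ⟪a p + C • p, z - p⟫ ≤
      f q + C / 2 * ‖q‖ ^ 2 + ⟪a q + C • q, z - q⟫ + C * ‖z - q‖ ^ 2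
    -- the two polarisation identities of CDGH, App. C, first display
    have e1 : ⟪a p + C • p, z - p⟫ = ⟪a p, z - p⟫ + C * ⟪p, z⟫ - C * ‖p‖ ^ 2 := by
      rw [inner_add_left, real_inner_smul_left, inner_sub_right p z p, real_inner_self_eq_norm_sq]; ring
    have e2 : ⟪a q + C • q, z - q⟫ = ⟪a q, z - q⟫ + C * ⟪q, z⟫ - C * ‖q‖ ^ 2 := by
      rw [inner_add_left, real_inner_smul_left, inner_sub_right q z q, real_inner_self_eq_norm_sq]; ring
    have e3 : ‖z - p‖ ^ 2 = ‖z‖ ^ 2 - 2 * ⟪p, z⟫ + ‖p‖ ^ 2 := by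
      rw [← real_inner_self_eq_norm_sq, ← real_inner_self_eq_norm_sq, ← real_inner_self_eq_norm_sq,
        inner_sub_left, inner_sub_right, inner_sub_right, real_inner_comm z p]; ring
    have e4 : ‖z - q‖ ^ 2 = ‖z‖ ^ 2 - 2 * ⟪q, z⟫ + ‖q‖ ^ 2 := by
      rw [← real_inner_self_eq_norm_sq, ← real_inner_self_eq_norm_sq, ← real_inner_self_eq_norm_sq,
        inner_sub_left, inner_sub_right, inner_sub_right, real_inner_comm z q]; ring
    rw [e1, e2]
    nlinarith [h, e3, e4]
  obtain ⟨Fn, Gn, hlow, hup, heq⟩ := exists_paraboloid_bounds_extension hC hA h65n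
  -- the Caffarelli–Cabré lemma for `Fn`
  have hgrad : ∀ x, HasGradientAt Fn (Gn x) x := hasGradientAt_of_paraboloid_bounds hC.le hlow hup
  have hlip : LipschitzWith (Real.toNNReal (4 * C)) Gn := lipschitzWith_of_paraboloid_bounds hC.le hlow hup
  -- denormalise
  set F : E → ℝ := fun x ↦ Fn x - C / 2 * ‖x‖ ^ 2 with hF
  set G : E → E := fun x ↦ Gn x - C • x with hG
  -- the gradient of `x ↦ (C/2)‖x‖²` is `C • x` (from the paraboloid lemma: it is its own paraboloid)
  have hpar : ∀ x₀ x : E,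
      C / 2 * ‖x‖ ^ 2 = C / 2 * ‖x₀‖ ^ 2 + ⟪C • x₀, x - x₀⟫ + C / 2 * ‖x - x₀‖ ^ 2 := by
    intro x₀ x
    rw [real_inner_smul_left, inner_sub_right, real_inner_self_eq_norm_sq]
    have e : ‖x - x₀‖ ^ 2 = ‖x‖ ^ 2 - 2 * ⟪x₀, x⟫ + ‖x₀‖ ^ 2 := by
      rw [← real_inner_self_eq_norm_sq, ← real_inner_self_eq_norm_sq, ← real_inner_self_eq_norm_sq,
        inner_sub_left, inner_sub_right, inner_sub_right, real_inner_comm x x₀]; ring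
    rw [e]; ring
  have hsq : ∀ x, HasGradientAt (fun x : E ↦ C / 2 * ‖x‖ ^ 2) (C • x) x :=
    hasGradientAt_of_paraboloid_bounds (F := fun x : E ↦ C / 2 * ‖x‖ ^ 2) (a := fun x₀ : E ↦ C • x₀)
      (C := C / 2) (by positivity)
      (fun x₀ x ↦ by
        rw [hpar x₀ x]
        have : 0 ≤ C / 2 * ‖x - x₀‖ ^ 2 := by positivity
        linarith)
      (fun x₀ x ↦ by rw [hpar x₀ x])
  have hgradF : ∀ x, HasGradientAt F (G x) x := by
    intro x
    have h1 := hgrad x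
    have h2 := hsq x
    rw [hasGradientAt_iff_hasFDerivAt] at h1 h2 ⊢
    have h3 := h1.sub h2
    rw [hG, map_sub]
    exact h3
  refine ⟨F, G, hgradF, ?_, ?_, fun p hp ↦ ?_⟩
  · -- Lipschitz constant `4C + C`
    have h1 : LipschitzWith (Real.toNNReal C) (fun x : E ↦ C • x) := by
      refine LipschitzWith.of_dist_le_mul fun x y ↦ ?_
      rw [dist_eq_norm, dist_eq_norm, ← smul_sub, norm_smul, Real.norm_eq_abs, abs_of_pos hC,
        Real.coe_toNNReal _ hC.le]
    have h2 := hlip.sub h1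
    refine h2.weaken ?_
    rw [← Real.toNNReal_add (by positivity) hC.le]
    exact Real.toNNReal_le_toNNReal (by linarith)
  · rw [contDiff_one_iff_hasFDerivAt]
    refine ⟨fun x ↦ toDual ℝ E (G x), ?_, fun x ↦ hgradF x⟩
    have hGc : Continuous G := hlip.continuous.sub (continuous_const.smul continuous_id)
    exact (toDual ℝ E).continuous.comp hGc
  · show Fn p - C / 2 * ‖p‖ ^ 2 = f p
    rw [heq p hp]
    show f p + C / 2 * ‖p‖ ^ 2 - C / 2 * ‖p‖ ^ 2 = f p
    ring

end Prop66

end Literature.Analysis.Convex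

end
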